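import Literature.IUT.HodgeTheaters.BadLocalFrobenioidOfKitsTemperedBiratReal
import Literature.AnabelianGeometry.EtaleTheta.ArithThetaTowerFrobenioid
import HarnessLib

/-!
# [IUTchI] Ex. 3.2 (ii)/(v) at the ARITHMETIC theta tower over `𝒟_v̲ = CosetCat Π_v̲`: the DATA fields
# `Θ̲_v`, `l·ℤ`, `𝒪^×_{K_v̲} → 𝒪^×(T^÷_{Ÿ_v})` of the REAL-birationalization rest input, produced from the
# decoupling spec `CarrierSpec` (GAP A item GA-06, FIELDS half of D6)

S. Mochizuki, *Inter-universal Teichmüller Theory I* [Mochizuki2012], Ex. 3.2 (ii) pp.70–71 («`ℱ÷_v := ℱ̲_v^birat`»,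
«`Θ̲_v ∈ 𝒪^×(T^÷_{Ÿ_v})`», «the action of the group of automorphisms `l·ℤ ⊆ Aut(T_{Ÿ_v})` [i.e., we write `ℤ` for
the group denoted `ℤ` in [EtTh], Theorem 5.7]», «the constants `𝒪^×_{K_v} → 𝒪^×(T^÷_{Ÿ_v})`»), (v) p.72
[claim: Mochizuki2012, status: disputed] (D-0012 claim key; DEFINITIONS only, nothing of the series asserted);
*The étale theta function …* [MochizukiEtTh2009] Def. 3.6 (ii) p.77 (the rational function monoid
`B = B₀^Λ|_D ×_{(Φ^{ℝ-log})^gp} Φ^gp`); *The geometry of Frobenioids I* [MochizukiFrdI2008] Thm. 5.2 (ii) p.101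
«Moreover … the rational function monoid of `𝒞` is naturally isomorphic to `B`» (`B(A) ≃* 𝒪^×(T^÷_A)`, the tree's
`BadLocalFrobenioid.temperedRatFnEquivBiratUnits`, BadLocalFrobenioidOfKitsTemperedBiratReal.lean §5).

GAP A of record G-L5-EX32I-1 (abc-iut cell), item GA-06 = the FIELDS half of row D6 of GAP-SIZING-A.md
69de97346848d3e8; ruled shape `plan/L5/GAP-A-SIGNATURES.md` v1 e3ccddf9b87597cf §5 (RULINGS #331): every D6 decl is stated
over the BINDERS `(C : TemperedFrobenioid T' T.Dv VD) (hC : ArithThetaTower.CarrierSpec d T C)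
(hF : PreFrobenioid.IsFrobenioid C.toElem)` — never over the term `temperedFrobenioid d T` (GA-12) — and GA-07 instantiates.
Shared binders (§0): `{p} [Fact p.Prime] (d : GaloisValDatum.{0} p) {P : Type} [Group P] [TopologicalSpace P]
(T : BadLocalGroupDatum d.Gal P)`; `T.Dv = CosetCat P`, `T.ydd = ⟨T.Y⟩` = `Ÿ_T`, `T.proj : T.Dv ⥤ CosetCat d.Gal`.

WHAT IS HERE (data producers; the functor `𝒞^Θ_v ⊆ ℱ÷_v` is the sibling file `ArithThetaTowerCThetaToBirat.lean`;
`CdashToC` + faithful + base = GA-13; the remaining laws and the ASSEMBLY of `thetaRestBirat_of_carrierSpec` = GA-16):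
* `ThetaRestBiratData d T C hF hq` — the data-first form of the slot's `TemperedThetaRestBirat d T hq C hF`
  (BadLocalFrobenioidOfKitsTemperedBiratReal.lean:101): its FOUR DATA fields `theta` / `lZ` / `constUnits` /
  `CThetaToBirat` VERBATIM; `ThetaRestBiratData.toRestBirat` assembles the slot structure from the data, GA-13's
  `CdashToC` triple and GA-16's two laws.  `ℱ÷_v := PreFrobenioid.Birat …`, `ℱ̲_v → ℱ÷_v := PreFrobenioid.toBirat` BY
  NAME and `𝒪^×(T^÷_{Ÿ_v}) := (BiratUnits.toAut _).range` are FORCED downstream by `TemperedThetaRestBirat.toRest`; the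
  `μ_{2l}` carve is `BadLocalFrobenioid.mu2l` — nothing to type here.
* From `hC.base_eq`: `CarrierSpec.baseIso` (`C.base.obj A ≅ A`) and the transports `CarrierSpec.trB` (`B₀^Λ(A) →
  B₀^Λ(Y_A)`), `CarrierSpec.ofLattice` (`Φ₀(A) → Φ(A)`, membership by `hC.Φ_carrier`).
* From `hC.theta`: the Θ̈-FRACTION `thetaRatFn hC : B(Ÿ_T)` = `(θ, [Z] − [Pl])` in the rational function monoid of the
  tempered Frobenioid (sub-gap (b) of D-G-L5-EX32I-1) and **`theta hC hF : BiratUnits C.toElem hF ⟨Ÿ_T, 0⟩`** := its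
  image under [FrdI] Thm. 5.2 (ii) `B(Ÿ_T) ≃* 𝒪^×(T^÷_{Ÿ_T})`, with `divHom_theta` (birational divisor `[Z] − [Pl]`).
* From `hC.lZ`: `deckLift hC : Aut_{𝒟_v̲}(Ÿ_T) →* Aut(T_{Ÿ_T})` and **`lZ hC l`** := the image of `l·`(deck
  transformations of `Ÿ_T`) (RULINGS #322 (c2′) «BY NAME, whatever it evaluates to at the given `T`»).
* From `hC.consts`: `constEmb = κ`, `constDivIncl = ι` with their five laws; **`constRatFn hC A : (Ω^{aug A})^× →* B(A)`**
  — GENUINE CONSTANTS AS RATIONAL FUNCTIONS AT EVERY OBJECT via `T.proj` (NOT via `rebase`; crit-A F2, RULINGS #321–#322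
  (c2′)), reusable by GA-13's `CdashToC` and by the functor file; `intUnitsToYdd : 𝒪^×_{K_v̲} → (Ω^{aug Ÿ_T})^×`
  (`aug Ÿ_T = G_v̲`: GENUINE `K_v̲`); **`constUnits hC hF`** — «`𝒪^×_{K_v} → 𝒪^×(T^÷_{Ÿ_v})`», injective.

carrier: genuine-by-[EtTh]-recipe on the T-lattice (Ÿ_T, Ÿ_T × V, X̲̲_v̲ × V) + constants everywhere; off-lattice Φ via
`rebase`/pullback; [EtTh] Def 3.3 Φ at general U and print's Ÿ̈/μ_N Kummer levels = FOUNDATIONS 13/14, not claimed (#322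
(c3′); this file defines no carrier, it reads the one `hC` specifies).  GUARD (#322): at a non-theta-type `T` the carrier is
print's recipe TRANSPORTED by (n_T, e(V|K_v̲)); the finite avatar of `l·ℤ` is LABELLED (FOUNDATIONS 13 U2), never `≅ ℤ`.
HONEST FRAMING: DATA producers over a `Prop`-valued spec; TYPED ≠ INHABITED (the term is GA-12's) ≠ proved-in-print; an
UNDISPUTED construction around [IUTchIII] Cor. 3.12, which stays OPEN by charter (D-0045) — no side taken on it or on any
author; nothing here asserts the abc conjecture proved or refuted; count-neutral.  No instance, no notation, no `sorry`.
-/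

noncomputable section

namespace Literature.AnabelianGeometry.EtaleTheta

namespace ArithThetaTower

open CategoryTheory Opposite Function Literature.AlgebraicGeometry.Frobenioids Literature.AnabelianGeometry.SemiGraphs
  Literature.IUT.HodgeTheaters Literature.AlgebraicGeometry.Frobenioids.PadicFrd

variable {p : ℕ} [Fact p.Prime] (d : GaloisValDatum.{0} p) {P : Type} [Group P] [TopologicalSpace P]
  (T : BadLocalGroupDatum d.Gal P)

/-- **`ThetaRestBiratData d T C hF hq`** — the four DATA fields of the slot structure `TemperedThetaRestBirat d T hq C hF`
([IUTchI] Ex. 3.2 (ii)/(v) with `ℱ÷_v := ℱ̲_v^birat` THE [FrdI] §4 birationalization), verbatim: (ii) `Θ̲_v ∈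
𝒪^×(T^÷_{Ÿ_v})`, (ii) `l·ℤ ⊆ Aut(T_{Ÿ_v})`, (v) the constants `𝒪^×_{K_v} → 𝒪^×(T^÷_{Ÿ_v})`, (v) the functor
`𝒞^Θ_v → ℱ÷_v`.  The LAWS (`CThetaToBirat` faithful, over `𝒟^Θ_v ⊆ (𝒟_v)_{Ÿ_v} → 𝒟_v`) and (iv) `𝒞⊢_v → 𝒞_v` faithful
over `𝒟⊢_v ⊆ 𝒟_v` are supplied to `toRestBirat` (GA-16, GA-13).  Interface DATA; typed ≠ inhabited.
([IUTchI] Ex 3.2 (ii) p.70) [claim: Mochizuki2012, status: disputed] -/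
structure ThetaRestBiratData {T' : RealifiedDivisorMonoids (D₀ := T.Dv) treeMonoidVocabWeak.{0}}
    {VD : FrdICatStub.{0, 0, 0} T.Dv} (C : TemperedFrobenioid T' T.Dv VD)
    (hF : PreFrobenioid.IsFrobenioid C.toElem) {qroot : intNonzero d.k} (hq : ¬ IsUnit qroot) where
  /-- (ii) `Θ̲_v ∈ 𝒪^×(T^÷_{Ÿ_v})` -/
  theta : PreFrobenioid.BiratUnits C.toElem hF (⟨T.ydd, 1⟩ : C.category)
  /-- (ii) `l·ℤ ⊆ Aut(T_{Ÿ_v})` -/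
  lZ : Subgroup (Aut (⟨T.ydd, 1⟩ : C.category))
  /-- (v) the constants `𝒪^×_{K_v} → 𝒪^×(T^÷_{Ÿ_v})` -/
  constUnits : (intNonzero d.k)ˣ →* PreFrobenioid.BiratUnits C.toElem hF (⟨T.ydd, 1⟩ : C.category)
  /-- (v) `𝒞^Θ_v → ℱ÷_v = ℱ̲_v^birat` -/
  CThetaToBirat : T.CTheta d hq ⥤ PreFrobenioid.Birat C.toElem hF (PreFrobenioid.hasBiratSquares_of_isFrobenioid hF)

namespace ThetaRestBiratData

variable {d T} {T' : RealifiedDivisorMonoids (D₀ := T.Dv) treeMonoidVocabWeak.{0}} {VD : FrdICatStub.{0, 0, 0} T.Dv}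
  {C : TemperedFrobenioid T' T.Dv VD} {hF : PreFrobenioid.IsFrobenioid C.toElem} {qroot : intNonzero d.k}
  {hq : ¬ IsUnit qroot}

/-- **ASSEMBLY of the slot structure from the data and the laws**: `TemperedThetaRestBirat d T hq C hF` from the four
data fields, GA-13's `CdashToC : 𝒞⊢_v → 𝒞_v` with `h₁` faithful and `h₂` over `𝒟⊢_v ⊆ 𝒟_v`, and GA-16's `h₃`
(`CThetaToBirat` faithful), `h₄` (over `𝒟^Θ_v ⊆ (𝒟_v)_{Ÿ_v} → 𝒟_v`).  `ℱ÷_v`, `toBirat`, `𝒪^×(T^÷_{Ÿ_v})` are then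
forced by `TemperedThetaRestBirat.toRest`. ([IUTchI] Ex 3.2 (ii) p.70) [claim: Mochizuki2012, status: disputed] -/
def toRestBirat (X : ThetaRestBiratData d T C hF hq) (CdashToC : d.Cdash hq ⥤ C.hullCategory)
    (h₁ : CdashToC.Faithful)
    (h₂ : Nonempty (CdashToC ⋙ C.hull ⋙ C.baseFunctorOfCategory ≅ d.CdashBase hq ⋙ T.incl))
    (h₃ : X.CThetaToBirat.Faithful)
    (h₄ : Nonempty (X.CThetaToBirat ⋙
      (PreFrobenioid.biratOps hF (PreFrobenioid.hasBiratSquares_of_isFrobenioid hF)).base ≅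
        T.CThetaBase d hq ⋙ T.dThetaIncl ⋙ Over.forget T.ydd)) :
    TemperedThetaRestBirat d T hq C hF where
  theta := X.theta
  lZ := X.lZ
  constUnits := X.constUnits
  CdashToC := CdashToC
  CdashToC_faithful := h₁
  CdashToC_base := h₂
  CThetaToBirat := X.CThetaToBirat
  CThetaToBirat_faithful := h₃
  CThetaToBirat_base := h₄

end ThetaRestBiratData

variable {d T} {T' : RealifiedDivisorMonoids (D₀ := T.Dv) treeMonoidVocabWeak.{0}} {VD : FrdICatStub.{0, 0, 0} T.Dv}
  {C : TemperedFrobenioid T' T.Dv VD}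

/-- Groupification homomorphisms out of `M^gp` are determined on `M` (universal property of `M → M^gp`). [folklore] -/
private theorem gp_hom_ext_of {M N : Type} [CommMonoid M] [CommGroup N]
    {f₁ f₂ : Algebra.GrothendieckGroup M →* N}
    (h : ∀ m : M, f₁ (Algebra.GrothendieckGroup.of m) = f₂ (Algebra.GrothendieckGroup.of m)) :
    f₁ = f₂ := by
  apply Algebra.GrothendieckGroup.lift.symm.injective
  rw [Algebra.GrothendieckGroup.lift_symm_apply, Algebra.GrothendieckGroup.lift_symm_apply]
  exact MonoidHom.ext h

namespace CarrierSpec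

/-! ## Transport along `base_eq : C.base = 𝟭` -/

/-- `Y_A = A`: the structure functor of a carrier satisfying the spec is the identity, as an isomorphism
`C.base.obj A ≅ A` of `𝒟_v̲` (an `eqToIso`; the identity at GA-12's term). [cite: MochizukiEtTh2009, Def 3.6 p.77] -/
def baseIso (hC : CarrierSpec d T C) (A : T.Dv) : C.base.obj A ≅ A :=
  eqToIso (Functor.congr_obj hC.base_eq A)

/-- Transport of log-meromorphic functions `B₀^Λ(A) → B₀^Λ(Y_A)` along `Y_A = A`. [cite: MochizukiEtTh2009, Def 3.6 p.77] -/
def trB (hC : CarrierSpec d T C) (A : T.Dv) : (T'.BΛ.obj (op A) : Type) →* (T'.BΛ.obj (C.baseOp (op A)) : Type) :=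
  (T'.BΛ.map (hC.baseIso A).hom.op).hom

/-- `trB` is injective (transport along an isomorphism). [cite: MochizukiEtTh2009, Def 3.6 p.77] -/
theorem trB_injective (hC : CarrierSpec d T C) (A : T.Dv) : Injective (hC.trB A) :=
  Function.LeftInverse.injective (g := (T'.BΛ.map (hC.baseIso A).inv.op).hom) fun x =>
    congrArg (fun φ => CommMonCat.Hom.hom φ x) ((T'.BΛ.mapIso (hC.baseIso A).op).hom_inv_id)

/-- **The lattice read in the divisor monoid**: `Φ₀(A) → Φ(A)`, `a ↦` the image of `a` under `Φ₀(A) = Φ₀(Y_A) → Φ₀^ℝ(Y_A)`,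
which lies in `Φ(A)` = the perf-saturation of that image (`hC.Φ_carrier`). [cite: MochizukiEtTh2009, Def 3.6 p.77] -/
def ofLattice (hC : CarrierSpec d T C) (A : T.Dv) : (T'.Φ₀.obj (op A) : Type) →* C.Φ.carrier (op A) :=
  ((T'.toR (C.baseOp (op A))).comp (T'.Φ₀.map (hC.baseIso A).hom.op).hom).codRestrict (C.Φ.carrier (op A))
    fun a => by
      rw [hC.Φ_carrier]
      refine ⟨1, ?_⟩
      rw [PNat.one_coe, pow_one]
      exact ⟨_, rfl⟩

/-- The value of `ofLattice` in `Φ^{ℝ-log}(A) = Φ₀^ℝ(Y_A)`. [cite: MochizukiEtTh2009, Def 3.6 p.77] -/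
theorem coe_ofLattice (hC : CarrierSpec d T C) (A : T.Dv) (a : T'.Φ₀.obj (op A)) :
    ((hC.ofLattice A a : C.Φ.carrier (op A)) : T'.ΦR.obj (C.baseOp (op A))) =
      (T'.ΦR.map (hC.baseIso A).hom.op).hom (T'.toR (op A) a) :=
  T'.toR_natural _ a

/-- On groupifications, `Φ(A)^gp → (Φ^{ℝ-log})^gp(A)` after `ofLattice^gp` is the transport of the lattice map `(toR)^gp`.
[cite: MochizukiEtTh2009, Def 3.6 p.77] -/
theorem ΦgpToRlog_gpMap_ofLattice (hC : CarrierSpec d T C) (A : T.Dv)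
    (x : Algebra.GrothendieckGroup (T'.Φ₀.obj (op A) : Type)) :
    C.ΦgpToRlog (op A) (gpMap (hC.ofLattice A) x) =
      gpMap (T'.ΦR.map (hC.baseIso A).hom.op).hom (gpMap (T'.toR (op A)) x) := by
  have key : (C.ΦgpToRlog (op A)).comp (gpMap (hC.ofLattice A)) =
      (gpMap (T'.ΦR.map (hC.baseIso A).hom.op).hom).comp (gpMap (T'.toR (op A))) :=
    gp_hom_ext_of fun a => by
      change gpMap (C.Φ.carrier (op A)).subtype (gpMap (hC.ofLattice A) (Algebra.GrothendieckGroup.of a)) =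
        gpMap _ (gpMap _ (Algebra.GrothendieckGroup.of a))
      rw [gpMap_of, gpMap_of, gpMap_of, gpMap_of]
      exact congrArg Algebra.GrothendieckGroup.of (hC.coe_ofLattice A a)
  exact DFunLike.congr_fun key x

/-! ## (ii) `Θ̲_v` from the `theta` clause -/

/-- The chosen rational function `θ ∈ B₀^Λ(Ÿ_T)` of the `theta` clause (genuine theta divisor shape `[cusps] − [D₁]`).
[cite: MochizukiEtTh2009, Def 3.6 p.77] -/
def thetaFn (hC : CarrierSpec d T C) : (T'.BΛ.obj (op T.ydd) : Type) := Classical.choose hC.theta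

/-- The chosen CUSPIDAL zero divisor `Z ∈ Φ₀(Ÿ_T)` of `θ`. [cite: MochizukiEtTh2009, Def 3.6 p.77] -/
def thetaZeros (hC : CarrierSpec d T C) : (T'.Φ₀.obj (op T.ydd) : Type) :=
  Classical.choose (Classical.choose_spec hC.theta)

/-- The chosen NON-CUSPIDAL pole divisor `Pl ∈ Φ₀(Ÿ_T)` of `θ`. [cite: MochizukiEtTh2009, Def 3.6 p.77] -/
def thetaPoles (hC : CarrierSpec d T C) : (T'.Φ₀.obj (op T.ydd) : Type) :=
  Classical.choose (Classical.choose_spec (Classical.choose_spec hC.theta))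

/-- The `theta` clause at the chosen data: `Z` cuspidal, `Pl` non-cuspidal, both `≠ 0`, coprime, `Div θ + [Pl] = [Z]`.
[cite: MochizukiEtTh2009, Def 3.6 p.77] -/
theorem thetaFn_spec (hC : CarrierSpec d T C) :
    hC.thetaZeros ∈ T'.csp₀ (op T.ydd) ∧ hC.thetaPoles ∈ T'.ncsp₀ (op T.ydd) ∧ hC.thetaZeros ≠ 1 ∧ hC.thetaPoles ≠ 1 ∧
      IsRelPrime hC.thetaZeros hC.thetaPoles ∧
      T'.divΛ (op T.ydd) hC.thetaFn * Algebra.GrothendieckGroup.of (T'.toR (op T.ydd) hC.thetaPoles) =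
        Algebra.GrothendieckGroup.of (T'.toR (op T.ydd) hC.thetaZeros) :=
  Classical.choose_spec (Classical.choose_spec (Classical.choose_spec hC.theta))

/-- `Div θ = [Z] − [Pl]` read through the lattice map. [cite: MochizukiEtTh2009, Def 3.6 p.77] -/
theorem divΛ_thetaFn (hC : CarrierSpec d T C) :
    T'.divΛ (op T.ydd) hC.thetaFn =
      Algebra.GrothendieckGroup.of (T'.toR (op T.ydd) hC.thetaZeros) /
        Algebra.GrothendieckGroup.of (T'.toR (op T.ydd) hC.thetaPoles) :=
  eq_div_of_mul_eq' hC.thetaFn_spec.2.2.2.2.2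

end CarrierSpec

/-- **The Θ̈-fraction `(θ, [Z] − [Pl]) ∈ B(Ÿ_T)`** — the rational function of the `theta` clause as an element of the
rational function monoid `B(Ÿ_T) = B₀^Λ(Y_{Ÿ_T}) ×_{(Φ^{ℝ-log})^gp} Φ(Ÿ_T)^gp` of the tempered Frobenioid ([EtTh] Def. 3.6
(ii)); its `Φ^gp`-component is `[Z] − [Pl]` with `Z`, `Pl` read in `Φ(Ÿ_T)` through the lattice (sub-gap (b) of
D-G-L5-EX32I-1: the Θ̈-content AT THE CARRIER). [cite: MochizukiEtTh2009, Def 3.6 p.77] -/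
def thetaRatFn (hC : CarrierSpec d T C) : (C.ratFnFunctor.obj (op T.ydd) : Type) :=
  ⟨(hC.trB T.ydd hC.thetaFn,
    Algebra.GrothendieckGroup.of (hC.ofLattice T.ydd hC.thetaZeros) /
      Algebra.GrothendieckGroup.of (hC.ofLattice T.ydd hC.thetaPoles)), by
    change T'.divΛ _ ((T'.BΛ.map (hC.baseIso T.ydd).hom.op).hom hC.thetaFn) = C.ΦgpToRlog (op T.ydd) _
    rw [T'.divΛ_natural, hC.divΛ_thetaFn, map_div, map_div, gpMap_of, gpMap_of,
      ← gpMap_of (hC.ofLattice T.ydd), ← gpMap_of (hC.ofLattice T.ydd), hC.ΦgpToRlog_gpMap_ofLattice,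
      hC.ΦgpToRlog_gpMap_ofLattice, gpMap_of, gpMap_of, gpMap_of, gpMap_of]⟩

/-- `Div_B` of the Θ̈-fraction is `[Z] − [Pl]`. [cite: MochizukiEtTh2009, Def 3.6 p.77] -/
theorem divB_thetaRatFn (hC : CarrierSpec d T C) :
    (C.divBNatTrans.app (op T.ydd)).hom (thetaRatFn hC) =
      Algebra.GrothendieckGroup.of (hC.ofLattice T.ydd hC.thetaZeros) /
        Algebra.GrothendieckGroup.of (hC.ofLattice T.ydd hC.thetaPoles) := rfl

/-- **(ii) `Θ̲_v ∈ 𝒪^×(T^÷_{Ÿ_v})`** — the image of the Θ̈-fraction under [FrdI] Thm. 5.2 (ii) «Moreover»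
`B(Ÿ_T) ≃* 𝒪^×(T^÷_{Ÿ_T})` (the birationalization `toBirat` BY NAME, through abc-iut-L1's `rationalFunctionMonoidStr`):
an element of the REAL unit group of the birational Frobenius-trivial object over `Ÿ_T` (RULINGS #322 (c2′) «`Θ̲ :=`
the theta unit at the matching skeleton level WITH its genuine divisor»). ([IUTchI] Ex 3.2 (ii) p.70)
[claim: Mochizuki2012, status: disputed] -/
def theta (hC : CarrierSpec d T C) (hF : PreFrobenioid.IsFrobenioid C.toElem) :
    PreFrobenioid.BiratUnits C.toElem hF (⟨T.ydd, 1⟩ : C.category) :=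
  BadLocalFrobenioid.temperedRatFnEquivBiratUnits C hF T.ydd (thetaRatFn hC)

/-- **The birational divisor of `Θ̲_v` is `[Z] − [Pl]`** (cuspidal zeros, non-cuspidal poles, coprime, both non-trivial —
`CarrierSpec.thetaFn_spec`). [cite: MochizukiFrdI2008, Thm. 5.2 (ii) p.101] -/
theorem divHom_theta (hC : CarrierSpec d T C) (hF : PreFrobenioid.IsFrobenioid C.toElem) :
    PreFrobenioid.BiratUnits.divHom hF (⟨T.ydd, 1⟩ : C.category) (theta hC hF) =
      Algebra.GrothendieckGroup.of (hC.ofLattice T.ydd hC.thetaZeros) /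
        Algebra.GrothendieckGroup.of (hC.ofLattice T.ydd hC.thetaPoles) :=
  BadLocalFrobenioid.divHom_temperedRatFnEquivBiratUnits C hF T.ydd (thetaRatFn hC)

/-! ## (ii) `l·ℤ ⊆ Aut(T_{Ÿ_v})` from the `lZ` clause -/

/-- The chosen lift `Aut_{𝒟_v̲}(Ÿ_T) →* Aut(T_{Ÿ_T})` of the `lZ` clause (deck transformations of `Ÿ_T` as
Frobenius-degree-one, divisor-free, unit-free automorphisms of `T_{Ÿ_T} = ⟨Ÿ_T, 0⟩`).
([IUTchI] Ex 3.2 (ii) p.71) [claim: Mochizuki2012, status: disputed] -/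
def deckLift (hC : CarrierSpec d T C) : Aut T.ydd →* Aut (⟨T.ydd, 1⟩ : C.category) :=
  Classical.choose hC.lZ

/-- `deckLift σ` lies over `σ` with trivial zero divisor and trivial unit. ([IUTchI] Ex 3.2 (ii) p.71)
[claim: Mochizuki2012, status: disputed] -/
theorem deckLift_spec (hC : CarrierSpec d T C) (σ : Aut T.ydd) :
    (deckLift hC σ).hom.base = σ.hom ∧ (deckLift hC σ).hom.div = 1 ∧ (deckLift hC σ).hom.unit = 1 :=
  Classical.choose_spec hC.lZ σ

/-- `deckLift` is injective (it lies over the identity on `Aut_{𝒟_v̲}(Ÿ_T)`). ([IUTchI] Ex 3.2 (ii) p.71)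
[claim: Mochizuki2012, status: disputed] -/
theorem deckLift_injective (hC : CarrierSpec d T C) : Injective (deckLift hC) := fun σ τ h =>
  Iso.ext (((deckLift_spec hC σ).1.symm.trans (by rw [h])).trans (deckLift_spec hC τ).1)

/-- **(ii) `l·ℤ ⊆ Aut(T_{Ÿ_v})`** — «we write `ℤ` for the group denoted `ℤ` in [EtTh], Theorem 5.7» (the deck
transformations): the image under `deckLift` of `l·`(deck transformations of `Ÿ_T`), i.e. of the subgroup generated by
the `l`-th powers (RULINGS #322 (c2′) «`lZ` := image of `l·`(deck translations of `Ÿ_T`) BY NAME, whatever it evaluates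
to at the given `T`»; small/`⊥` when `n_T ∣ l`: a LABELLED finite-avatar consequence, FOUNDATIONS 13 U2 — the infinite
tempered covering `Ÿ_v → X̲̲_v` with `Gal = l·ℤ × μ₂` is not claimed). ([IUTchI] Ex 3.2 (ii) p.71)
[claim: Mochizuki2012, status: disputed] -/
def lZ (hC : CarrierSpec d T C) (l : ℕ) : Subgroup (Aut (⟨T.ydd, 1⟩ : C.category)) :=
  (Subgroup.closure (Set.range fun σ : Aut T.ydd => σ ^ l)).map (deckLift hC)

/-- `l·ℤ` lies inside the image of all deck transformations. ([IUTchI] Ex 3.2 (ii) p.71) [claim: Mochizuki2012, status: disputed] -/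
theorem lZ_le_range (hC : CarrierSpec d T C) (l : ℕ) : lZ hC l ≤ (deckLift hC).range :=
  Subgroup.map_le_range _ _

/-- The `l`-th power of a lifted deck transformation lies in `l·ℤ`. ([IUTchI] Ex 3.2 (ii) p.71) [claim: Mochizuki2012, status: disputed] -/
theorem deckLift_pow_mem_lZ (hC : CarrierSpec d T C) (l : ℕ) (σ : Aut T.ydd) : deckLift hC σ ^ l ∈ lZ hC l :=
  ⟨σ ^ l, Subgroup.subset_closure ⟨σ, rfl⟩, map_pow _ σ l⟩

/-! ## (v) the constants from the `consts` clause -/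

namespace CarrierSpec

/-- `κ : (Ω^{aug ·})^× → B₀^Λ`, the chosen embedding of the GENUINE constant tower (through `T.proj ⋙ d.fieldFunctor`)
into the log-meromorphic functions. [cite: MochizukiEtTh2009, Def 3.6 p.77] -/
def constEmb (hC : CarrierSpec d T C) : PadicFrd.bZeroOn (T.proj ⋙ d.fieldFunctor) ⟶ T'.BΛ :=
  Classical.choose hC.consts

/-- `ι_Y : ord(𝒪^▷_{Ω^{aug Y}}) → Φ₀(Y)`, the chosen embedding of the genuine value monoids into the lattice.
[cite: MochizukiEtTh2009, Def 3.6 p.77] -/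
def constDivIncl (hC : CarrierSpec d T C) (Y : T.Dvᵒᵖ) :
    PadicFrd.OrdInt (d.fieldFunctor.obj (T.proj.obj (unop Y))).K →* (T'.Φ₀.obj Y : Type) :=
  Classical.choose (Classical.choose_spec hC.consts) Y

/-- The five laws of `(κ, ι)`. [cite: MochizukiEtTh2009, Def 3.6 p.77] -/
theorem consts_spec (hC : CarrierSpec d T C) :
    (∀ Y : T.Dvᵒᵖ, Injective (hC.constEmb.app Y).hom) ∧ (∀ Y : T.Dvᵒᵖ, Injective (hC.constDivIncl Y)) ∧
      (∀ (Y : T.Dvᵒᵖ) (u : ((d.fieldFunctor.obj (T.proj.obj (unop Y))).K)ˣ), (hC.constEmb.app Y).hom u ∈ T'.FΛ Y) ∧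
      (∀ {Y Y' : T.Dvᵒᵖ} (f : Y ⟶ Y') (x : PadicFrd.OrdInt (d.fieldFunctor.obj (T.proj.obj (unop Y))).K),
        (T'.Φ₀.map f).hom (hC.constDivIncl Y x) =
          hC.constDivIncl Y' (PadicFrd.ordIntMapOfHom (d.fieldFunctor.map (T.proj.map f.unop)).alg
            (d.fieldFunctor.map (T.proj.map f.unop)).isValHom x)) ∧
      (∀ (Y : T.Dvᵒᵖ) (u : ((d.fieldFunctor.obj (T.proj.obj (unop Y))).K)ˣ),
        T'.divΛ Y ((hC.constEmb.app Y).hom u) =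
          gpMap (T'.toR Y) (gpMap (hC.constDivIncl Y) (PadicFrd.divUnits (d.fieldFunctor.obj (T.proj.obj (unop Y))).K u))) :=
  Classical.choose_spec (Classical.choose_spec hC.consts)

/-- `κ` is injective. [cite: MochizukiEtTh2009, Def 3.6 p.77] -/
theorem constEmb_injective (hC : CarrierSpec d T C) (Y : T.Dvᵒᵖ) : Injective (hC.constEmb.app Y).hom :=
  hC.consts_spec.1 Y

/-- `ι` is injective. [cite: MochizukiEtTh2009, Def 3.6 p.77] -/
theorem constDivIncl_injective (hC : CarrierSpec d T C) (Y : T.Dvᵒᵖ) : Injective (hC.constDivIncl Y) :=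
  hC.consts_spec.2.1 Y

/-- `κ` lands in the constants `F₀^Λ`. [cite: MochizukiEtTh2009, Def 3.6 p.77] -/
theorem constEmb_mem_FΛ (hC : CarrierSpec d T C) (Y : T.Dvᵒᵖ) (u : ((d.fieldFunctor.obj (T.proj.obj (unop Y))).K)ˣ) :
    (hC.constEmb.app Y).hom u ∈ T'.FΛ Y :=
  hC.consts_spec.2.2.1 Y u

/-- `Div` of a constant is its valuation, read through `ι` and the lattice map. [cite: MochizukiEtTh2009, Def 3.6 p.77] -/
theorem divΛ_constEmb (hC : CarrierSpec d T C) (Y : T.Dvᵒᵖ) (u : ((d.fieldFunctor.obj (T.proj.obj (unop Y))).K)ˣ) :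
    T'.divΛ Y ((hC.constEmb.app Y).hom u) =
      gpMap (T'.toR Y) (gpMap (hC.constDivIncl Y) (PadicFrd.divUnits (d.fieldFunctor.obj (T.proj.obj (unop Y))).K u)) :=
  hC.consts_spec.2.2.2.2 Y u

end CarrierSpec

/-- **GENUINE CONSTANTS AS RATIONAL FUNCTIONS AT EVERY OBJECT** (via `T.proj`, NOT via `rebase`; RULINGS #321/#322 (c2′),
crit-A F2): `(Ω^{aug A})^× → B(A)`, `u ↦ (κ u, (toR ∘ ι)^gp (div u))` — a genuine constant with its genuine valuation as
an element of the tempered Frobenioid's rational function monoid.  The sub-gap (a) lever (GA-13's `CdashToC`) and the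
constants of `𝒞^Θ_v ⊆ ℱ÷_v` both factor through this map. [cite: MochizukiEtTh2009, Def 3.6 p.77] -/
def constRatFn (hC : CarrierSpec d T C) (A : T.Dv) :
    ((d.fieldFunctor.obj (T.proj.obj A)).K)ˣ →* (C.ratFnFunctor.obj (op A) : Type) :=
  (((hC.trB A).comp (hC.constEmb.app (op A)).hom).prod
      ((gpMap (hC.ofLattice A)).comp ((gpMap (hC.constDivIncl (op A))).comp
        (PadicFrd.divUnits (d.fieldFunctor.obj (T.proj.obj A)).K)))).codRestrict (C.ratFn (op A)) fun u => by
    change T'.divΛ _ ((T'.BΛ.map (hC.baseIso A).hom.op).hom ((hC.constEmb.app (op A)).hom u)) =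
      C.ΦgpToRlog (op A) (gpMap (hC.ofLattice A) (gpMap (hC.constDivIncl (op A))
        (PadicFrd.divUnits (d.fieldFunctor.obj (T.proj.obj A)).K u)))
    rw [hC.ΦgpToRlog_gpMap_ofLattice]
    exact (T'.divΛ_natural _ _).trans (congrArg _ (hC.divΛ_constEmb (op A) u))

/-- The function component of `constRatFn u` is (the transport of) the constant `κ u`. [cite: MochizukiEtTh2009, Def 3.6 p.77] -/
theorem constRatFn_fst (hC : CarrierSpec d T C) (A : T.Dv) (u : ((d.fieldFunctor.obj (T.proj.obj A)).K)ˣ) :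
    (constRatFn hC A u).1.1 = hC.trB A ((hC.constEmb.app (op A)).hom u) := rfl

/-- `Div_B` of the constant `u` is its valuation read in `Φ(A)^gp`. [cite: MochizukiEtTh2009, Def 3.6 p.77] -/
theorem divB_constRatFn (hC : CarrierSpec d T C) (A : T.Dv) (u : ((d.fieldFunctor.obj (T.proj.obj A)).K)ˣ) :
    (C.divBNatTrans.app (op A)).hom (constRatFn hC A u) =
      gpMap (hC.ofLattice A) (gpMap (hC.constDivIncl (op A)) (PadicFrd.divUnits (d.fieldFunctor.obj (T.proj.obj A)).K u)) :=
  rfl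

/-- `constRatFn` is injective (`κ` is). [cite: MochizukiEtTh2009, Def 3.6 p.77] -/
theorem constRatFn_injective (hC : CarrierSpec d T C) (A : T.Dv) : Injective (constRatFn hC A) := fun u v h =>
  hC.constEmb_injective (op A) (hC.trB_injective A
    ((constRatFn_fst hC A u).symm.trans ((congrArg (fun b => b.1.1) h).trans (constRatFn_fst hC A v))))

/-- `𝒪^×_{K_v̲} → (Ω^{aug Ÿ_T})^×`: a unit of the integers of `K_v̲` as a unit of the base field of `Ÿ_T` (`aug(Π_Ÿ) = G_v̲`,
so `Ω^{aug Ÿ_T} = K_v̲` — «the base field of `Ÿ_v` is equal to `K_v`», Ex. 3.2 (v) — along `K_v̲ → Ω^{aug Ÿ_T}`).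
([IUTchI] Ex 3.2 (v) p.72) [claim: Mochizuki2012, status: disputed] -/
def intUnitsToYdd : (intNonzero d.k)ˣ →* ((d.fieldFunctor.obj (T.proj.obj T.ydd)).K)ˣ :=
  (Units.map (algebraMap d.k (d.fixedFld (T.proj.obj T.ydd)) : d.k →* d.fixedFld (T.proj.obj T.ydd))).comp
    (Units.map (intNonzero d.k).subtype)

/-- `intUnitsToYdd` is injective. ([IUTchI] Ex 3.2 (v) p.72) [claim: Mochizuki2012, status: disputed] -/
theorem intUnitsToYdd_injective : Injective (intUnitsToYdd (d := d) (T := T)) :=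
  (Units.map_injective (f := (algebraMap d.k (d.fixedFld (T.proj.obj T.ydd)) : d.k →* d.fixedFld (T.proj.obj T.ydd)))
      (algebraMap d.k (d.fixedFld (T.proj.obj T.ydd))).injective).comp
    (Units.map_injective Subtype.coe_injective)

/-- **(v) the constants `𝒪^×_{K_v} → 𝒪^×(T^÷_{Ÿ_v})`**: GENUINE units of `K_v̲` as birational units of `T_{Ÿ_T}`, through
`constRatFn` at `Ÿ_T` and [FrdI] Thm. 5.2 (ii) `B(Ÿ_T) ≃* 𝒪^×(T^÷_{Ÿ_T})`. ([IUTchI] Ex 3.2 (v) p.72)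
[claim: Mochizuki2012, status: disputed] -/
def constUnits (hC : CarrierSpec d T C) (hF : PreFrobenioid.IsFrobenioid C.toElem) :
    (intNonzero d.k)ˣ →* PreFrobenioid.BiratUnits C.toElem hF (⟨T.ydd, 1⟩ : C.category) :=
  ((BadLocalFrobenioid.temperedRatFnEquivBiratUnits C hF T.ydd).toMonoidHom.comp (constRatFn hC T.ydd)).comp
    (intUnitsToYdd (d := d) (T := T))

/-- **`𝒪^×_{K_v} ↪ 𝒪^×(T^÷_{Ÿ_v})` is injective** (genuine constants: `κ` injective). ([IUTchI] Ex 3.2 (v) p.72)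
[claim: Mochizuki2012, status: disputed] -/
theorem constUnits_injective (hC : CarrierSpec d T C) (hF : PreFrobenioid.IsFrobenioid C.toElem) :
    Injective (constUnits hC hF) :=
  ((BadLocalFrobenioid.temperedRatFnEquivBiratUnits C hF T.ydd).injective.comp (constRatFn_injective hC T.ydd)).comp
    intUnitsToYdd_injective

/-- The birational divisor of the constant `u` is its (genuine) valuation read in `Φ(Ÿ_T)^gp`.
[cite: MochizukiFrdI2008, Thm. 5.2 (ii) p.101] -/
theorem divHom_constUnits (hC : CarrierSpec d T C) (hF : PreFrobenioid.IsFrobenioid C.toElem) (u : (intNonzero d.k)ˣ) :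
    PreFrobenioid.BiratUnits.divHom hF (⟨T.ydd, 1⟩ : C.category) (constUnits hC hF u) =
      gpMap (hC.ofLattice T.ydd) (gpMap (hC.constDivIncl (op T.ydd))
        (PadicFrd.divUnits (d.fieldFunctor.obj (T.proj.obj T.ydd)).K (intUnitsToYdd u))) :=
  BadLocalFrobenioid.divHom_temperedRatFnEquivBiratUnits C hF T.ydd _

end ArithThetaTower

end Literature.AnabelianGeometry.EtaleTheta

end
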